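import Literature.NumberTheory.LFunctions.TwistedLSeries
import Literature.NumberTheory.DiophantineApproximation.KroneckerPrimes
import Literature.Analysis.Complex.Hurwitz
import Mathlib.NumberTheory.EulerProduct.Basic
import Mathlib.NumberTheory.LSeries.Deriv
import Mathlib.NumberTheory.LSeries.Linearity
import Mathlib.NumberTheory.LSeries.Injectivity
import Mathlib.Analysis.Complex.Convex
import Mathlib.Analysis.SpecialFunctions.Complex.LogBounds
import Mathlib.Analysis.SpecialFunctions.Pow.Asymptotics
import Mathlib.Analysis.Normed.Group.Tannery
import HarnessLib

/-!
# Conrey–Ghosh 1994, Theorem 2 — the twisted-Euler-product engine (generic Dirichlet series)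

Proofs only (no definitions, no named facts); sibling of `DavenportHeilbronnDegreeTwo.lean`, used by
`DavenportHeilbronnDegreeTwoNewforms.lean` (the modular input `Δ² = C(A − B)`) and
`DavenportHeilbronnDegreeTwoCert.lean` (the finite certificate and `ConreyGhosh1994_thm2_holds`).
Everything here is about GENERAL Dirichlet series with real Hecke-type coefficients; it formalises
§8 of Conrey–Ghosh (Trans. AMS 342 (1994), pp. 415–417) with the Lemma of §9 (Rankin–Selberg,
Shahidi) replaced by a finite certificate hypothesis:

1. **Euler products on the real axis** (`LSeries_hasProd_of_recurrence'`,
   `hasProd_re_LSeries_of_recurrence`, `eulerQuadratic_pos`, `re_LSeries_pos_and_hasSum_log`,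
   `sum_log_le_log_re_LSeries_sub`, `re_LSeries_lt_of_prod_lt`): for `a(1) = 1`, `a` multiplicative,
   `a(p^{r+2}) = a(p)a(p^{r+1}) − e(p)a(p^r)`, at a real point of absolute convergence
   `L_a(σ) = ∏_p (1 − a(p)p^{-σ} + e(p)p^{-2σ})⁻¹ > 0`, every denominator is POSITIVE on the whole
   half-line (no Ramanujan bound needed: it never vanishes, is continuous and tends to `1`), and
   `log L_a − log L_b ≥ ∑_{p∈T}(log q_b(p) − log q_a(p))` when `q_a ≤ q_b` off the finite set `T` —
   the reduction of "`A^χ(σ₁) > B^χ(σ₁)`" (p. 417: "we conclude that `Z(1+δ) > 0`") to finitely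
   many primes.
2. **The sign far to the right and the real zero** (`tendsto_two_rpow_mul_LSeries`,
   `eventually_re_LSeries_neg`, `exists_LSeries_ofReal_eq_zero`): `2^σ ∑ c(n)n^{-σ} → c(2)`, and the
   intermediate value theorem ("Therefore `Z(s)` has a zero in `1 < σ < 1 + δ`").
3. **From a zero of the twist to a zero of the series** (`LSeries_shift_sub_twist`,
   `exists_forall_norm_shift_sub_twist_le`, `exists_LSeries_eq_zero_of_twist_zero`): property (2)
   of p. 415 ("`|Z(s) − G(s + iT)| < ε` … follows from Kronecker's theorem") via
   `Literature.NumberTheory.DiophantineApproximation.Kronecker.exists_abs_ge_forall_prime_norm_cpow_sub_lt`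
   and the complete multiplicativity bookkeeping of `Literature.NumberTheory.LFunctions.TwistedLSeries`,
   then the existence half of Hurwitz's theorem (`Literature/Analysis/Complex/Hurwitz.lean`) in
   place of Rouché; the degenerate case `Z ≡ 0` is handled by the injectivity of the Dirichlet
   transform (Mathlib `LSeries_eventually_eq_zero_iff'`).
4. **Assembly of 1–2** (`exists_real_zero_of_cert`): for two real Hecke-type systems `a`, `b` and a
   completely multiplicative sign `ε` with `ε(2)(a(2) − b(2)) < 0`, `ε(p)(a(p) − b(p)) ≥ 0` (`p`
   odd), a finite certificate `∏_{p∈T} q_{εa}(p)(σ₁) < ∏_{p∈T} q_{εb}(p)(σ₁)` yields a real zero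
   `σ₀ > σ₁` of `∑ ε(n)(a(n) − b(n))n^{-σ}`.

## References

* [ConreyGhosh1994] J. B. Conrey, A. Ghosh, Trans. Amer. Math. Soc. 342 (1994), 407–419, §8
  (read: PDF pp. 8–11 of the held copy `paper:doi-10-2307-2154701`).
* [DiamondShurman2005] F. Diamond, J. Shurman, GTM 228, Thm. 5.9.2 and its proof, (5.24)–(5.26).
* [Titchmarsh1986] E. C. Titchmarsh, *The Theory of the Riemann Zeta-Function*, §10.25.
-/

noncomputable section

open Complex Filter Metric Set Topology LSeries
open Literature.NumberTheory.LFunctions (shiftPhase shiftPhase_apply norm_shiftPhase_prime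
  complMul_shiftPhase norm_complMul_sub_complMul_le)

namespace Literature.Barriers.RiemannHypothesis

/-! ## The Euler product of a Dirichlet series with Hecke-type coefficients -/

/-- **Euler product of a Dirichlet series with Hecke-type coefficients** (Diamond–Shurman, proof
of Thm. 5.9.2): `a 1 = 1`, `a (m n) = a m · a n` for coprime `m, n`,
`a (p^{r+2}) = a p · a (p^{r+1}) − e p · a (p^r)`, and absolute convergence at `s` give
`∑ a n n^{-s} = ∏_p (1 − a p · p^{-s} + e p · p^{-2s})⁻¹` (`HasProd` over `Nat.Primes`), every
denominator being non-zero. (As `Literature.NumberTheory.Automorphic.LSeries_hasProd_of_recurrence`,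
reproved to keep the import graph small.) [cite: DiamondShurman2005, Thm. 5.9.2 and its proof] -/
theorem LSeries_hasProd_of_recurrence' {a e : ℕ → ℂ} (h1 : a 1 = 1)
    (hmulc : ∀ {m n : ℕ}, m.Coprime n → a (m * n) = a m * a n)
    (hrec : ∀ {p : ℕ}, p.Prime → ∀ r : ℕ, a (p ^ (r + 2)) = a p * a (p ^ (r + 1)) - e p * a (p ^ r))
    {s : ℂ} (hs : LSeriesSummable a s) :
    HasProd (fun p : Nat.Primes ↦
      (1 - a p * (p : ℂ) ^ (-s) + e p * ((p : ℂ) ^ (-s)) ^ 2)⁻¹) (LSeries a s) ∧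
    ∀ p : Nat.Primes, 1 - a p * (p : ℂ) ^ (-s) + e p * ((p : ℂ) ^ (-s)) ^ 2 ≠ 0 := by
  -- the local factor identity `(∑_r c_r x^r)(1 − a x + b x²) = 1` (Diamond–Shurman (5.24); as
  -- `Literature.NumberTheory.Automorphic.ModularForms.tsum_mul_eq_one_of_recurrence`)
  have tsum_key : ∀ {a' b x : ℂ} {c : ℕ → ℂ}, c 0 = 1 → c 1 = a' →
      (∀ r, c (r + 2) = a' * c (r + 1) - b * c r) → (Summable fun r ↦ c r * x ^ r) →
      (∑' r, c r * x ^ r) * (1 - a' * x + b * x ^ 2) = 1 := by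
    intro a' b x c h0 h1' hrec' hs'
    set u : ℕ → ℂ := fun r ↦ c r * x ^ r with hu
    have hs1 : Summable fun r ↦ u (r + 1) := (summable_nat_add_iff 1).mpr hs'
    have e0 : ∑' r, u r = 1 + ∑' r, u (r + 1) := by
      rw [hs'.tsum_eq_zero_add]
      simp [hu, h0]
    have e1 : ∑' r, u (r + 1) = a' * x + ∑' r, u (r + 2) := by
      rw [hs1.tsum_eq_zero_add]
      simp [hu, h1']
    have e2 : ∑' r, u (r + 2) = a' * x * ∑' r, u (r + 1) - b * x ^ 2 * ∑' r, u r := by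
      rw [← tsum_mul_left, ← tsum_mul_left, ← (hs1.mul_left _).tsum_sub (hs'.mul_left _)]
      refine tsum_congr fun r ↦ ?_
      simp only [hu, hrec']
      ring
    change (∑' r, u r) * _ = 1
    linear_combination (1 - a' * x) * e0 + e1 + e2
  set G : ℕ → ℂ := LSeries.term a s with hG
  have hGn : ∀ {n : ℕ}, n ≠ 0 → G n = a n * (n : ℂ) ^ (-s) := fun hn ↦ by
    rw [hG, LSeries.term_of_ne_zero hn, div_eq_mul_inv, ← cpow_neg]
  have hG0 : G 0 = 0 := LSeries.term_zero a s
  have hG1 : G 1 = 1 := by rw [hGn one_ne_zero, h1, Nat.cast_one, one_cpow, mul_one]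
  have hGmul : ∀ {m n : ℕ}, m.Coprime n → G (m * n) = G m * G n := by
    intro m n hmn
    rcases eq_or_ne m 0 with rfl | hm
    · rw [zero_mul, hG0, zero_mul]
    rcases eq_or_ne n 0 with rfl | hn
    · rw [mul_zero, hG0, mul_zero]
    rw [hGn (mul_ne_zero hm hn), hGn hm, hGn hn, hmulc hmn, Nat.cast_mul,
      natCast_mul_natCast_cpow]
    ring
  have hsum : Summable fun n ↦ ‖G n‖ := summable_norm_iff.mpr hs
  have hEP := EulerProduct.eulerProduct_hasProd hG1 hGmul hsum hG0
  have hkey : ∀ p : Nat.Primes, (∑' r : ℕ, G ((p : ℕ) ^ r)) *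
      (1 - a p * (p : ℂ) ^ (-s) + e p * ((p : ℂ) ^ (-s)) ^ 2) = 1 := by
    intro p
    have hp : (p : ℕ).Prime := p.2
    have hGp : ∀ r : ℕ, G ((p : ℕ) ^ r) = a ((p : ℕ) ^ r) * ((p : ℂ) ^ (-s)) ^ r := fun r ↦ by
      rw [hGn (pow_ne_zero _ hp.ne_zero), Nat.cast_pow, ← natCast_cpow_natCast_mul,
        ← cpow_nat_mul]
    have hsx : Summable fun r : ℕ ↦ a ((p : ℕ) ^ r) * ((p : ℂ) ^ (-s)) ^ r := by
      have := hsum.of_norm.comp_injective (Nat.pow_right_injective hp.two_le)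
      simpa only [Function.comp_def, hGp] using this
    have key := tsum_key (x := (p : ℂ) ^ (-s)) (a' := a p)
      (b := e p) (c := fun r ↦ a ((p : ℕ) ^ r))
      (by simp only [pow_zero, h1]) (by simp only [pow_one]) (hrec hp) hsx
    simp_rw [hGp]
    exact key
  have hfactor : ∀ p : Nat.Primes, ∑' r : ℕ, G ((p : ℕ) ^ r) =
      (1 - a p * (p : ℂ) ^ (-s) + e p * ((p : ℂ) ^ (-s)) ^ 2)⁻¹ := fun p ↦
    eq_inv_of_mul_eq_one_left (hkey p)
  refine ⟨?_, fun p h0 ↦ ?_⟩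
  · rw [LSeries, show (fun p : Nat.Primes ↦ (1 - a p * (p : ℂ) ^ (-s) +
        e p * ((p : ℂ) ^ (-s)) ^ 2)⁻¹) = fun p : Nat.Primes ↦ ∑' r : ℕ, G ((p : ℕ) ^ r) from
        funext fun p ↦ (hfactor p).symm]
    exact hEP
  · have := hkey p
    rw [h0, mul_zero] at this
    exact zero_ne_one this

/-! ## Real coefficients: the Euler product on the real axis -/

/-- **The Euler product on the real axis.** For REAL Hecke-type coefficients `a`, `e` and a real
point `σ` of absolute convergence, `L_a(σ) = ∑ a(n)n^{-σ}` is real and equals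
`∏_p (1 − a(p)p^{-σ} + e(p)p^{-2σ})⁻¹` (a convergent product of real numbers), no denominator
vanishing. [cite: DiamondShurman2005, Thm. 5.9.2] -/
theorem hasProd_re_LSeries_of_recurrence {a e : ℕ → ℝ} (h1 : a 1 = 1)
    (hmulc : ∀ {m n : ℕ}, m.Coprime n → a (m * n) = a m * a n)
    (hrec : ∀ {p : ℕ}, p.Prime → ∀ r : ℕ, a (p ^ (r + 2)) = a p * a (p ^ (r + 1)) - e p * a (p ^ r))
    {σ : ℝ} (hs : LSeriesSummable (fun n ↦ (a n : ℂ)) σ) :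
    HasProd (fun p : Nat.Primes ↦
      (1 - a p * (p : ℝ) ^ (-σ) + e p * ((p : ℝ) ^ (-σ)) ^ 2)⁻¹) (LSeries (fun n ↦ (a n : ℂ)) σ).re ∧
    (LSeries (fun n ↦ (a n : ℂ)) σ).im = 0 ∧
    ∀ p : Nat.Primes, 1 - a p * (p : ℝ) ^ (-σ) + e p * ((p : ℝ) ^ (-σ)) ^ 2 ≠ 0 := by
  obtain ⟨hP, hne⟩ := LSeries_hasProd_of_recurrence' (a := fun n ↦ (a n : ℂ))
    (e := fun n ↦ (e n : ℂ)) (by simp [h1]) (fun hmn ↦ by simp [hmulc hmn])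
    (fun hp r ↦ by simp [hrec hp r]) hs
  have hpow : ∀ p : Nat.Primes, ((p : ℕ) : ℂ) ^ (-(σ : ℂ)) = (((p : ℝ) ^ (-σ) : ℝ) : ℂ) := by
    intro p
    rw [Complex.ofReal_cpow (Nat.cast_nonneg _)]
    push_cast
    rfl
  have hfac : ∀ p : Nat.Primes, (1 - (a p : ℂ) * ((p : ℕ) : ℂ) ^ (-(σ : ℂ)) +
      (e p : ℂ) * (((p : ℕ) : ℂ) ^ (-(σ : ℂ))) ^ 2) =
        ((1 - a p * (p : ℝ) ^ (-σ) + e p * ((p : ℝ) ^ (-σ)) ^ 2 : ℝ) : ℂ) := by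
    intro p
    rw [hpow p]
    push_cast
    ring
  have hF : (fun p : Nat.Primes ↦ (1 - (a p : ℂ) * ((p : ℕ) : ℂ) ^ (-(σ : ℂ)) +
      (e p : ℂ) * (((p : ℕ) : ℂ) ^ (-(σ : ℂ))) ^ 2)⁻¹) = fun p : Nat.Primes ↦
        (((1 - a p * (p : ℝ) ^ (-σ) + e p * ((p : ℝ) ^ (-σ)) ^ 2)⁻¹ : ℝ) : ℂ) := by
    funext p
    rw [hfac p]
    push_cast
    rfl
  rw [hF] at hP
  set L := LSeries (fun n ↦ (a n : ℂ)) σ with hL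
  set g : Nat.Primes → ℝ := fun p ↦ (1 - a p * (p : ℝ) ^ (-σ) + e p * ((p : ℝ) ^ (-σ)) ^ 2)⁻¹
    with hg
  have hP' : Tendsto (fun S : Finset Nat.Primes ↦ ((∏ p ∈ S, g p : ℝ) : ℂ)) atTop (𝓝 L) := by
    have := hP
    rw [HasProd] at this
    refine this.congr fun S ↦ ?_
    rw [Complex.ofReal_prod]
  refine ⟨?_, ?_, fun p h0 ↦ hne p ?_⟩
  · have h2 := (Complex.continuous_re.tendsto L).comp hP'
    rw [HasProd]
    refine h2.congr fun S ↦ ?_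
    simp only [Function.comp_apply, Complex.ofReal_re]
  · have h3 := (Complex.continuous_im.tendsto L).comp hP'
    have h4 : (Complex.im ∘ fun S : Finset Nat.Primes ↦ ((∏ p ∈ S, g p : ℝ) : ℂ)) = fun _ ↦ 0 := by
      funext S
      simp only [Function.comp_apply, Complex.ofReal_im]
    rw [h4] at h3
    exact tendsto_nhds_unique h3 tendsto_const_nhds
  · rw [hfac p, h0]
    push_cast
    rfl

/-! ## Positivity of the Euler denominators -/

/-- A real function which is continuous and zero-free on a half-line `(σ₀, ∞)` and tends to `1`
at `+∞` is positive on that half-line (intermediate value theorem). [folklore] -/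
theorem pos_of_continuousOn_of_forall_ne_zero {q : ℝ → ℝ} {σ₀ : ℝ}
    (hc : ContinuousOn q (Set.Ioi σ₀)) (hne : ∀ σ, σ₀ < σ → q σ ≠ 0)
    (ht : Tendsto q atTop (𝓝 1)) {σ : ℝ} (hσ : σ₀ < σ) : 0 < q σ := by
  by_contra hle
  push Not at hle
  obtain ⟨N, hN⟩ := eventually_atTop.1 (ht.eventually (lt_mem_nhds one_pos))
  set σ₂ : ℝ := max N (σ + 1) with hσ₂
  have hσσ₂ : σ ≤ σ₂ := by rw [hσ₂]; exact le_trans (by linarith) (le_max_right _ _)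
  have hq₂ : 0 < q σ₂ := hN σ₂ (le_max_left _ _)
  have hcont : ContinuousOn q (Set.Icc σ σ₂) := hc.mono fun x hx ↦ lt_of_lt_of_le hσ hx.1
  obtain ⟨x, hx, hx0⟩ := intermediate_value_Icc hσσ₂ hcont ⟨hle, hq₂.le⟩
  exact hne x (lt_of_lt_of_le hσ hx.1) hx0

/-- **Every Euler denominator is positive on the half-line of absolute convergence.** If
`q(σ) = 1 − α p^{-σ} + β p^{-2σ}` (`p ≥ 2`, `α, β` real) does not vanish for `σ > σ₀`, then
`q(σ) > 0` for `σ > σ₀` — no bound on `α` (no Ramanujan–Deligne estimate) is needed.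
[cite: ConreyGhosh1994, §8, p. 416] -/
theorem eulerQuadratic_pos {p : ℕ} (hp : 2 ≤ p) (α β : ℝ) {σ₀ : ℝ}
    (hne : ∀ σ, σ₀ < σ → 1 - α * (p : ℝ) ^ (-σ) + β * ((p : ℝ) ^ (-σ)) ^ 2 ≠ 0)
    {σ : ℝ} (hσ : σ₀ < σ) : 0 < 1 - α * (p : ℝ) ^ (-σ) + β * ((p : ℝ) ^ (-σ)) ^ 2 := by
  have hp0 : (0 : ℝ) < p := by exact_mod_cast lt_of_lt_of_le zero_lt_two hp
  have hcpow : Continuous fun σ : ℝ ↦ (p : ℝ) ^ (-σ) :=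
    (Real.continuous_const_rpow hp0.ne').comp continuous_neg
  have hc : Continuous fun σ : ℝ ↦ 1 - α * (p : ℝ) ^ (-σ) + β * ((p : ℝ) ^ (-σ)) ^ 2 := by
    fun_prop
  -- `p^{-σ} → 0`
  have h0 : Tendsto (fun σ : ℝ ↦ (p : ℝ) ^ (-σ)) atTop (𝓝 0) := by
    have h := tendsto_rpow_atTop_of_base_lt_one ((p : ℝ)⁻¹)
      (by linarith [inv_pos.2 hp0]) (inv_lt_one_of_one_lt₀ (by exact_mod_cast hp))
    refine h.congr fun σ ↦ ?_
    rw [Real.inv_rpow hp0.le, Real.rpow_neg hp0.le]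
  have ht : Tendsto (fun σ : ℝ ↦ 1 - α * (p : ℝ) ^ (-σ) + β * ((p : ℝ) ^ (-σ)) ^ 2)
      atTop (𝓝 1) := by
    have h := ((h0.const_mul α).const_sub 1).add ((h0.pow 2).const_mul β)
    simpa using h
  exact pos_of_continuousOn_of_forall_ne_zero hc.continuousOn hne ht hσ

/-! ## `L_a(σ) > 0` and the logarithm of the Euler product -/

/-- **`L_a(σ) > 0` and `log L_a(σ) = −∑_p log(1 − a(p)p^{-σ} + e(p)p^{-2σ})`** on the real axis,
for real Hecke-type coefficients, at a real point of absolute convergence where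
`∑_p (|a(p)|p^{-σ} + |e(p)|p^{-2σ}) < ∞` and all Euler denominators are positive: the partial
Euler products are exponentials of partial sums of a convergent series of logarithms.
[cite: ConreyGhosh1994, §8, p. 416] -/
theorem re_LSeries_pos_and_hasSum_log {a e : ℕ → ℝ} (h1 : a 1 = 1)
    (hmulc : ∀ {m n : ℕ}, m.Coprime n → a (m * n) = a m * a n)
    (hrec : ∀ {p : ℕ}, p.Prime → ∀ r : ℕ, a (p ^ (r + 2)) = a p * a (p ^ (r + 1)) - e p * a (p ^ r))
    {σ : ℝ} (hs : LSeriesSummable (fun n ↦ (a n : ℂ)) σ)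
    (hu : Summable fun p : Nat.Primes ↦ |a p| * (p : ℝ) ^ (-σ) + |e p| * ((p : ℝ) ^ (-σ)) ^ 2)
    (hq : ∀ p : Nat.Primes, 0 < 1 - a p * (p : ℝ) ^ (-σ) + e p * ((p : ℝ) ^ (-σ)) ^ 2) :
    0 < (LSeries (fun n ↦ (a n : ℂ)) σ).re ∧
    HasSum (fun p : Nat.Primes ↦ -Real.log (1 - a p * (p : ℝ) ^ (-σ) + e p * ((p : ℝ) ^ (-σ)) ^ 2))
      (Real.log (LSeries (fun n ↦ (a n : ℂ)) σ).re) := by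
  obtain ⟨hP, -, -⟩ := hasProd_re_LSeries_of_recurrence h1 hmulc hrec hs
  -- `|log(1 + u)| ≤ 2|u|` for `|u| ≤ 1/2`
  have abs_log_one_add_le : ∀ {u : ℝ}, |u| ≤ 1 / 2 → |Real.log (1 + u)| ≤ 2 * |u| := by
    intro u hu
    have h1 : |(-u)| < 1 := by rw [abs_neg]; linarith
    have h := Real.abs_log_sub_add_sum_range_le h1 0
    simp only [Finset.range_zero, Finset.sum_empty, zero_add, sub_neg_eq_add, pow_one,
      abs_neg] at h
    have h2 : |u| / (1 - |u|) ≤ 2 * |u| := by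
      rw [div_le_iff₀ (by linarith)]
      nlinarith [abs_nonneg u]
    exact h.trans h2
  set q : Nat.Primes → ℝ := fun p ↦ 1 - a p * (p : ℝ) ^ (-σ) + e p * ((p : ℝ) ^ (-σ)) ^ 2
    with hq_def
  -- the logarithms are summable
  have hsmall : ∀ᶠ p : Nat.Primes in cofinite,
      |a p| * (p : ℝ) ^ (-σ) + |e p| * ((p : ℝ) ^ (-σ)) ^ 2 < 1 / 2 :=
    hu.tendsto_cofinite_zero.eventually (gt_mem_nhds (by norm_num))
  have hbound : ∀ᶠ p : Nat.Primes in cofinite, ‖Real.log (q p)‖ ≤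
      2 * (|a p| * (p : ℝ) ^ (-σ) + |e p| * ((p : ℝ) ^ (-σ)) ^ 2) := by
    filter_upwards [hsmall] with p hp
    have hu1 : |q p - 1| ≤ |a p| * (p : ℝ) ^ (-σ) + |e p| * ((p : ℝ) ^ (-σ)) ^ 2 := by
      have hx : 0 ≤ (p : ℝ) ^ (-σ) := Real.rpow_nonneg (Nat.cast_nonneg _) _
      have : q p - 1 = -(a p * (p : ℝ) ^ (-σ)) + e p * ((p : ℝ) ^ (-σ)) ^ 2 := by
        rw [hq_def]; ring
      rw [this]
      refine (abs_add_le _ _).trans (le_of_eq ?_)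
      rw [abs_neg, abs_mul, abs_mul, abs_of_nonneg hx, abs_of_nonneg (sq_nonneg ((p : ℝ) ^ (-σ)))]
    have h := abs_log_one_add_le (u := q p - 1) (hu1.trans hp.le)
    rw [add_sub_cancel] at h
    rw [Real.norm_eq_abs]
    exact h.trans (by linarith)
  have hlog : Summable fun p : Nat.Primes ↦ Real.log (q p) :=
    Summable.of_norm_bounded_eventually (hu.mul_left 2) hbound
  set T : ℝ := ∑' p : Nat.Primes, -Real.log (q p) with hT
  have hTsum : HasSum (fun p : Nat.Primes ↦ -Real.log (q p)) T := hlog.neg.hasSum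
  -- partial Euler products are exponentials of partial sums
  have hprod : ∀ S : Finset Nat.Primes, ∏ p ∈ S, (q p)⁻¹ = Real.exp (∑ p ∈ S, -Real.log (q p)) := by
    intro S
    rw [Real.exp_sum]
    refine Finset.prod_congr rfl fun p _ ↦ ?_
    rw [Real.exp_neg, Real.exp_log (hq p)]
  have hP2 : HasProd (fun p : Nat.Primes ↦ (q p)⁻¹) (Real.exp T) := by
    rw [HasProd]
    have h := (Real.continuous_exp.tendsto T).comp hTsum
    refine h.congr fun S ↦ ?_
    simp only [Function.comp_apply, hprod S]
  have hEq : (LSeries (fun n ↦ (a n : ℂ)) σ).re = Real.exp T := hP.unique hP2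
  refine ⟨by rw [hEq]; exact Real.exp_pos T, ?_⟩
  rw [hEq, Real.log_exp]
  exact hTsum

/-! ## Comparing two Euler products: reduction to a finite inequality -/

/-- **Reduction of `L_a(σ) > L_b(σ)` to finitely many primes.** For two real Hecke-type
coefficient systems `a`, `b` with the same `e`, both in the situation of
`re_LSeries_pos_and_hasSum_log` at `σ`, and a finite set of primes `T` such that
`q_a(p) ≤ q_b(p)` for every prime `p ∉ T` (`q_a(p) = 1 − a(p)p^{-σ} + e(p)p^{-2σ}`):
`∑_{p ∈ T} (log q_b(p) − log q_a(p)) ≤ log L_a(σ) − log L_b(σ)`. (Conrey–Ghosh choose the twist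
`χ(p) = sgn α(p)` … so that the local factors compare prime by prime; here the comparison
outside `T` is the hypothesis and the primes in `T` are left to a finite computation.)
[cite: ConreyGhosh1994, §8, pp. 415–417] -/
theorem sum_log_le_log_re_LSeries_sub {a b e : ℕ → ℝ} (ha1 : a 1 = 1) (hb1 : b 1 = 1)
    (hamul : ∀ {m n : ℕ}, m.Coprime n → a (m * n) = a m * a n)
    (hbmul : ∀ {m n : ℕ}, m.Coprime n → b (m * n) = b m * b n)
    (harec : ∀ {p : ℕ}, p.Prime → ∀ r : ℕ, a (p ^ (r + 2)) = a p * a (p ^ (r + 1)) - e p * a (p ^ r))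
    (hbrec : ∀ {p : ℕ}, p.Prime → ∀ r : ℕ, b (p ^ (r + 2)) = b p * b (p ^ (r + 1)) - e p * b (p ^ r))
    {σ : ℝ} (has : LSeriesSummable (fun n ↦ (a n : ℂ)) σ)
    (hbs : LSeriesSummable (fun n ↦ (b n : ℂ)) σ)
    (hau : Summable fun p : Nat.Primes ↦ |a p| * (p : ℝ) ^ (-σ) + |e p| * ((p : ℝ) ^ (-σ)) ^ 2)
    (hbu : Summable fun p : Nat.Primes ↦ |b p| * (p : ℝ) ^ (-σ) + |e p| * ((p : ℝ) ^ (-σ)) ^ 2)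
    (haq : ∀ p : Nat.Primes, 0 < 1 - a p * (p : ℝ) ^ (-σ) + e p * ((p : ℝ) ^ (-σ)) ^ 2)
    (hbq : ∀ p : Nat.Primes, 0 < 1 - b p * (p : ℝ) ^ (-σ) + e p * ((p : ℝ) ^ (-σ)) ^ 2)
    (T : Finset Nat.Primes)
    (hcomp : ∀ p : Nat.Primes, p ∉ T →
      1 - a p * (p : ℝ) ^ (-σ) + e p * ((p : ℝ) ^ (-σ)) ^ 2 ≤
        1 - b p * (p : ℝ) ^ (-σ) + e p * ((p : ℝ) ^ (-σ)) ^ 2) :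
    0 < (LSeries (fun n ↦ (a n : ℂ)) σ).re ∧ 0 < (LSeries (fun n ↦ (b n : ℂ)) σ).re ∧
    ∑ p ∈ T, (Real.log (1 - b p * (p : ℝ) ^ (-σ) + e p * ((p : ℝ) ^ (-σ)) ^ 2) -
        Real.log (1 - a p * (p : ℝ) ^ (-σ) + e p * ((p : ℝ) ^ (-σ)) ^ 2)) ≤
      Real.log (LSeries (fun n ↦ (a n : ℂ)) σ).re - Real.log (LSeries (fun n ↦ (b n : ℂ)) σ).re := by
  obtain ⟨hapos, haS⟩ := re_LSeries_pos_and_hasSum_log ha1 hamul harec has hau haq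
  obtain ⟨hbpos, hbS⟩ := re_LSeries_pos_and_hasSum_log hb1 hbmul hbrec hbs hbu hbq
  refine ⟨hapos, hbpos, ?_⟩
  have hsub := haS.sub hbS
  refine le_of_eq_of_le (Finset.sum_congr rfl fun p _ ↦ by ring) (sum_le_hasSum T (fun p hp ↦ ?_) hsub)
  have := Real.log_le_log (haq p) (hcomp p hp)
  linarith

/-- **The finite certificate form.** In the situation of `sum_log_le_log_re_LSeries_sub`, if the
finite products over `T` satisfy `∏_{p∈T} q_a(p) < ∏_{p∈T} q_b(p)`, then `L_b(σ) < L_a(σ)`.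
[cite: ConreyGhosh1994, §8, pp. 415–417] -/
theorem re_LSeries_lt_of_prod_lt {a b e : ℕ → ℝ} (ha1 : a 1 = 1) (hb1 : b 1 = 1)
    (hamul : ∀ {m n : ℕ}, m.Coprime n → a (m * n) = a m * a n)
    (hbmul : ∀ {m n : ℕ}, m.Coprime n → b (m * n) = b m * b n)
    (harec : ∀ {p : ℕ}, p.Prime → ∀ r : ℕ, a (p ^ (r + 2)) = a p * a (p ^ (r + 1)) - e p * a (p ^ r))
    (hbrec : ∀ {p : ℕ}, p.Prime → ∀ r : ℕ, b (p ^ (r + 2)) = b p * b (p ^ (r + 1)) - e p * b (p ^ r))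
    {σ : ℝ} (has : LSeriesSummable (fun n ↦ (a n : ℂ)) σ)
    (hbs : LSeriesSummable (fun n ↦ (b n : ℂ)) σ)
    (hau : Summable fun p : Nat.Primes ↦ |a p| * (p : ℝ) ^ (-σ) + |e p| * ((p : ℝ) ^ (-σ)) ^ 2)
    (hbu : Summable fun p : Nat.Primes ↦ |b p| * (p : ℝ) ^ (-σ) + |e p| * ((p : ℝ) ^ (-σ)) ^ 2)
    (haq : ∀ p : Nat.Primes, 0 < 1 - a p * (p : ℝ) ^ (-σ) + e p * ((p : ℝ) ^ (-σ)) ^ 2)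
    (hbq : ∀ p : Nat.Primes, 0 < 1 - b p * (p : ℝ) ^ (-σ) + e p * ((p : ℝ) ^ (-σ)) ^ 2)
    (T : Finset Nat.Primes)
    (hcomp : ∀ p : Nat.Primes, p ∉ T →
      1 - a p * (p : ℝ) ^ (-σ) + e p * ((p : ℝ) ^ (-σ)) ^ 2 ≤
        1 - b p * (p : ℝ) ^ (-σ) + e p * ((p : ℝ) ^ (-σ)) ^ 2)
    (hcert : ∏ p ∈ T, (1 - a p * (p : ℝ) ^ (-σ) + e p * ((p : ℝ) ^ (-σ)) ^ 2) <
      ∏ p ∈ T, (1 - b p * (p : ℝ) ^ (-σ) + e p * ((p : ℝ) ^ (-σ)) ^ 2)) :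
    (LSeries (fun n ↦ (b n : ℂ)) σ).re < (LSeries (fun n ↦ (a n : ℂ)) σ).re := by
  obtain ⟨hapos, hbpos, hle⟩ := sum_log_le_log_re_LSeries_sub ha1 hb1 hamul hbmul harec hbrec
    has hbs hau hbu haq hbq T hcomp
  have hprodpos : 0 < ∏ p ∈ T, (1 - a p * (p : ℝ) ^ (-σ) + e p * ((p : ℝ) ^ (-σ)) ^ 2) :=
    Finset.prod_pos fun p _ ↦ haq p
  have hlog := Real.log_lt_log hprodpos hcert
  rw [Real.log_prod (s := T) (fun p _ ↦ (haq p).ne'), Real.log_prod (s := T) (fun p _ ↦ (hbq p).ne'),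
    ← sub_pos, ← Finset.sum_sub_distrib] at hlog
  have h := lt_of_lt_of_le hlog hle
  rw [sub_pos] at h
  exact (Real.log_lt_log_iff hbpos hapos).1 h


/-- `(2/n)^σ → 0` as `σ → +∞` for `n ≥ 3`. [folklore] -/
theorem tendsto_two_div_rpow_atTop {n : ℕ} (hn : 3 ≤ n) :
    Tendsto (fun σ : ℝ ↦ (2 / (n : ℝ)) ^ σ) atTop (𝓝 0) := by
  have hn0 : (0 : ℝ) < n := by exact_mod_cast (by omega : 0 < n)
  refine tendsto_rpow_atTop_of_base_lt_one _ ?_ ?_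
  · have : (0 : ℝ) < 2 / n := by positivity
    linarith
  · rw [div_lt_one hn0]
    exact_mod_cast (by omega : 2 < n)

/-- The norm of `2^σ · c(n) n^{-σ}` is `‖c(n)‖ (2/n)^σ` (`n ≥ 1`). [folklore] -/
theorem norm_two_rpow_mul_term {c : ℕ → ℂ} (σ : ℝ) {n : ℕ} (hn : n ≠ 0) :
    ‖(((2 : ℝ) ^ σ : ℝ) : ℂ) * term c σ n‖ = ‖c n‖ * (2 / (n : ℝ)) ^ σ := by
  rw [norm_mul, Complex.norm_real, Real.norm_of_nonneg (Real.rpow_nonneg zero_le_two _),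
    norm_term_eq, if_neg hn, ofReal_re, Real.div_rpow zero_le_two (Nat.cast_nonneg _)]
  ring

/-- **The sign far to the right.** If `c(1) = 0` and `∑ c(n) n^{-s}` converges absolutely at
the real point `σ'`, then `2^σ ∑ c(n) n^{-σ} → c(2)` as `σ → +∞` (Tannery / dominated
convergence with the majorant `2^{σ'}‖c(n)‖n^{-σ'}`). [folklore] -/
theorem tendsto_two_rpow_mul_LSeries {c : ℕ → ℂ} (hc1 : c 1 = 0) {σ' : ℝ}
    (hs : LSeriesSummable c σ') :
    Tendsto (fun σ : ℝ ↦ (((2 : ℝ) ^ σ : ℝ) : ℂ) * LSeries c σ) atTop (𝓝 (c 2)) := by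
  set f : ℝ → ℕ → ℂ := fun σ n ↦ (((2 : ℝ) ^ σ : ℝ) : ℂ) * term c σ n with hf
  set g : ℕ → ℂ := fun n ↦ if n = 2 then c 2 else 0 with hg
  have hfsum : ∀ σ : ℝ, (((2 : ℝ) ^ σ : ℝ) : ℂ) * LSeries c σ = ∑' n, f σ n := fun σ ↦ by
    rw [LSeries, ← tsum_mul_left]
  have hgsum : ∑' n, g n = c 2 := by rw [hg]; exact tsum_ite_eq 2 (fun _ : ℕ ↦ c 2)
  simp_rw [hfsum, ← hgsum]
  refine tendsto_tsum_of_dominated_convergence (bound := fun n ↦ (2 : ℝ) ^ σ' * ‖term c σ' n‖)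
    (hs.norm.mul_left _) (fun n ↦ ?_) ?_
  · -- pointwise limits
    rcases eq_or_ne n 0 with rfl | hn0
    · simp [hf, hg]
    rcases eq_or_ne n 1 with rfl | hn1
    · simp [hf, hg, hc1]
    rcases eq_or_ne n 2 with rfl | hn2
    · simp only [hg, if_pos rfl, hf]
      refine tendsto_const_nhds.congr fun σ ↦ ?_
      rw [term_of_ne_zero two_ne_zero, Nat.cast_two,
        show (2 : ℂ) ^ (σ : ℂ) = (((2 : ℝ) ^ σ : ℝ) : ℂ) by
          rw [Complex.ofReal_cpow zero_le_two]; norm_num]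
      have h2 : (((2 : ℝ) ^ σ : ℝ) : ℂ) ≠ 0 :=
        ofReal_ne_zero.2 (Real.rpow_pos_of_pos two_pos σ).ne'
      field_simp
    · have hn3 : 3 ≤ n := by omega
      simp only [hg, if_neg hn2]
      rw [tendsto_zero_iff_norm_tendsto_zero]
      have h := (tendsto_two_div_rpow_atTop hn3).const_mul ‖c n‖
      rw [mul_zero] at h
      exact h.congr fun σ ↦ (norm_two_rpow_mul_term σ hn0).symm
  · -- domination for `σ ≥ σ'`
    filter_upwards [eventually_ge_atTop σ'] with σ hσ n
    rcases eq_or_ne n 0 with rfl | hn0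
    · simp [hf]
    rw [hf, norm_two_rpow_mul_term σ hn0, norm_term_eq, if_neg hn0, ofReal_re]
    rcases eq_or_ne n 1 with rfl | hn1
    · simp [hc1]
    have hn2 : (2 : ℝ) ≤ n := by exact_mod_cast (by omega : 2 ≤ n)
    have hn0' : (0 : ℝ) < n := by linarith
    have hbase : (2 : ℝ) / n ≤ 1 := (div_le_one hn0').2 hn2
    have hbase0 : (0 : ℝ) < 2 / n := by positivity
    calc ‖c n‖ * (2 / (n : ℝ)) ^ σ ≤ ‖c n‖ * (2 / (n : ℝ)) ^ σ' :=
          mul_le_mul_of_nonneg_left (Real.rpow_le_rpow_of_exponent_ge hbase0 hbase hσ)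
            (norm_nonneg _)
      _ = 2 ^ σ' * (‖c n‖ / (n : ℝ) ^ σ') := by
          rw [Real.div_rpow zero_le_two (Nat.cast_nonneg _)]; ring

/-- Hence, if the values of the series on the real axis are real and `Re c(2) < 0`, the series is
negative at all sufficiently large real points. [folklore] -/
theorem eventually_re_LSeries_neg {c : ℕ → ℂ} (hc1 : c 1 = 0) {σ' : ℝ}
    (hs : LSeriesSummable c σ') (hc2 : (c 2).re < 0) :
    ∀ᶠ σ : ℝ in atTop, (LSeries c σ).re < 0 := by
  have h := (Complex.continuous_re.tendsto _).comp (tendsto_two_rpow_mul_LSeries hc1 hs)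
  have h2 := h.eventually (gt_mem_nhds hc2)
  filter_upwards [h2] with σ hσ
  simp only [Function.comp_apply, re_ofReal_mul] at hσ
  have h2σ : (0 : ℝ) < (2 : ℝ) ^ σ := Real.rpow_pos_of_pos two_pos σ
  by_contra hge
  push Not at hge
  have := mul_nonneg h2σ.le hge
  linarith

/-- **A real zero by the intermediate value theorem.** Let `∑ c(n)n^{-s}` take real values at
the real points of its half-plane of absolute convergence. If it is positive at `σ₁` and negative
at `σ₂ > σ₁`, `σ₁` to the right of the abscissa of absolute convergence, then it vanishes at some
real `σ₀ ∈ (σ₁, σ₂)`. [cite: ConreyGhosh1994, §8, p. 417] -/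
theorem exists_LSeries_ofReal_eq_zero {c : ℕ → ℂ} {σ₁ σ₂ : ℝ} (h12 : σ₁ < σ₂)
    (habs : abscissaOfAbsConv c < σ₁)
    (hreal : ∀ σ : ℝ, σ₁ ≤ σ → (LSeries c σ).im = 0)
    (hpos : 0 < (LSeries c σ₁).re) (hneg : (LSeries c σ₂).re < 0) :
    ∃ σ₀ : ℝ, σ₁ < σ₀ ∧ σ₀ < σ₂ ∧ LSeries c σ₀ = 0 := by
  -- continuity of `σ ↦ Re L(σ)` on `[σ₁, σ₂]`
  have hcont : ContinuousOn (fun σ : ℝ ↦ (LSeries c σ).re) (Set.Icc σ₁ σ₂) := by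
    refine Complex.continuous_re.comp_continuousOn ?_
    refine ContinuousOn.comp (s := Set.Icc σ₁ σ₂) (LSeries_analyticOnNhd c).continuousOn
      Complex.continuous_ofReal.continuousOn fun σ hσ ↦ ?_
    show abscissaOfAbsConv c < ((σ : ℂ)).re
    rw [ofReal_re]
    exact lt_of_lt_of_le habs (by exact_mod_cast hσ.1)
  obtain ⟨σ₀, hσ₀, h0⟩ := intermediate_value_Icc' h12.le hcont ⟨hneg.le, hpos.le⟩
  have hσ₀1 : σ₁ < σ₀ := by
    rcases eq_or_lt_of_le hσ₀.1 with h | h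
    · rw [← h] at h0; simp only at h0; linarith
    · exact h
  have hσ₀2 : σ₀ < σ₂ := by
    rcases eq_or_lt_of_le hσ₀.2 with h | h
    · rw [h] at h0; simp only at h0; linarith
    · exact h
  refine ⟨σ₀, hσ₀1, hσ₀2, ?_⟩
  apply Complex.ext
  · simpa using h0
  · simpa using hreal σ₀ hσ₀.1


/-! ## Unimodular twists -/

/-- `|X(n)| = 1` for `n ≥ 1` when `|e(p)| = 1` at the primes (`X = complMul e`). [folklore] -/
theorem norm_complMul_eq_one {e : ℕ → ℂ} (he : ∀ p, p.Prime → ‖e p‖ = 1) {n : ℕ} (hn : n ≠ 0) :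
    ‖complMul e n‖ = 1 := by
  induction n using Nat.recOnPosPrimePosCoprime with
  | prime_pow p k hp hk => rw [complMul_prime_pow e hp, norm_pow, he p hp, one_pow]
  | zero => exact absurd rfl hn
  | one => simp
  | coprime a b ha hb hab iha ihb =>
    rw [map_mul, norm_mul, iha (by omega), ihb (by omega), one_mul]

/-- Summability of a coefficientwise bounded modification: if `‖c n‖ ≤ K` then
`∑ c(n)u(n)n^{-s}` converges absolutely wherever `∑ u(n)n^{-s}` does. [folklore] -/
theorem LSeriesSummable_mul_of_norm_le {u c : ℕ → ℂ} {K : ℝ} (hc : ∀ n, ‖c n‖ ≤ K) {s : ℂ}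
    (hs : LSeriesSummable u s) : LSeriesSummable (fun n ↦ c n * u n) s := by
  have hK : 0 ≤ K := (norm_nonneg _).trans (hc 0)
  refine Summable.of_norm_bounded (g := fun n ↦ K * ‖term u s n‖) (hs.norm.mul_left K) fun n ↦ ?_
  rcases eq_or_ne n 0 with rfl | hn
  · simp
  rw [norm_term_eq, norm_term_eq, if_neg hn, if_neg hn, norm_mul, mul_div_assoc]
  exact mul_le_mul_of_nonneg_right (hc n) (by positivity)

/-- The abscissa of absolute convergence does not increase under such a modification. [folklore] -/
theorem abscissaOfAbsConv_mul_le {u c : ℕ → ℂ} {K : ℝ} (hc : ∀ n, ‖c n‖ ≤ K) :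
    abscissaOfAbsConv (fun n ↦ c n * u n) ≤ abscissaOfAbsConv u := by
  refine abscissaOfAbsConv_le_of_forall_lt_LSeriesSummable' fun x hx ↦ ?_
  exact LSeriesSummable_mul_of_norm_le hc (LSeriesSummable_of_abscissaOfAbsConv_lt_re (by simpa using hx))

/-! ## `G(s − it) − Z(s)` as one Dirichlet series -/

/-- `∑ u(n) n^{-(s − it)} = ∑ n^{it}u(n) n^{-s}`. [folklore] -/
theorem LSeries_shift_eq (u : ℕ → ℂ) (s : ℂ) (t : ℝ) :
    LSeries u (s - t * I) = LSeries (fun n ↦ (n : ℂ) ^ ((t : ℂ) * I) * u n) s := by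
  refine tsum_congr fun n ↦ ?_
  rcases eq_or_ne n 0 with rfl | hn
  · simp
  have hn' : (n : ℂ) ≠ 0 := Nat.cast_ne_zero.2 hn
  rw [term_of_ne_zero hn, term_of_ne_zero hn, Complex.cpow_sub _ _ hn', div_div_eq_mul_div]
  congr 1
  rw [show (t : ℂ) * I = -(-(t * I)) by ring, Complex.cpow_neg]
  field_simp

/-- **`G(s − it) − Z(s) = ∑ (n^{it} − X(n)) u(n) n^{-s}`** in the half-plane of absolute
convergence of `∑ u(n)n^{-s}` (`X = complMul e`, `|e(p)| = 1`). [cite: ConreyGhosh1994, §8, p. 416] -/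
theorem LSeries_shift_sub_twist {u e : ℕ → ℂ} (he : ∀ p, p.Prime → ‖e p‖ = 1) {s : ℂ}
    (hs : LSeriesSummable u s) (t : ℝ) :
    LSeries u (s - t * I) - LSeries (fun n ↦ complMul e n * u n) s =
      LSeries (fun n ↦ ((n : ℂ) ^ ((t : ℂ) * I) - complMul e n) * u n) s := by
  have h1 : LSeriesSummable (fun n ↦ (n : ℂ) ^ ((t : ℂ) * I) * u n) s := by
    refine LSeriesSummable_mul_of_norm_le (K := 1) (fun n ↦ ?_) hs
    rcases eq_or_ne n 0 with rfl | hn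
    · rcases eq_or_ne ((t : ℂ) * I) 0 with h0 | h0
      · simp [h0]
      · simp [zero_cpow h0]
    · rw [norm_natCast_cpow_of_pos (Nat.pos_of_ne_zero hn)]
      simp
  have h2 : LSeriesSummable (fun n ↦ complMul e n * u n) s :=
    LSeriesSummable_mul_of_norm_le (K := 1) (norm_complMul_le_one fun p hp ↦ (he p hp).le) hs
  rw [LSeries_shift_eq, ← LSeries_sub h1 h2]
  congr 1
  funext n
  simp only [Pi.sub_apply]
  ring

/-! ## Property (2): uniform approximation on a disc -/

/-- **Property (2) of Conrey–Ghosh, quantitative.** Let `∑ |u(n)| n^{-σ₁} < ∞` and let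
`D = closedBall s₀ r` lie in `Re s ≥ σ₁`. For every `ε > 0` there are `Q` and `η > 0` such that
`|p^{it} − e(p)| < η` for the primes `p ≤ Q` forces `|G(s − it) − Z(s)| ≤ ε` for all `s ∈ D`.
[cite: ConreyGhosh1994, §8, p. 416] -/
theorem exists_forall_norm_shift_sub_twist_le {u e : ℕ → ℂ} (he : ∀ p, p.Prime → ‖e p‖ = 1)
    {σ₁ : ℝ} (hσ₁ : LSeriesSummable u σ₁) {s₀ : ℂ} {r : ℝ}
    (hD : ∀ s ∈ closedBall s₀ r, σ₁ ≤ s.re) {ε : ℝ} (hε : 0 < ε) :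
    ∃ Q : ℕ, ∃ η : ℝ, 0 < η ∧ ∀ t : ℝ,
      (∀ p : ℕ, p.Prime → p ≤ Q → ‖(p : ℂ) ^ ((t : ℂ) * I) - e p‖ < η) →
        ∀ s ∈ closedBall s₀ r,
          ‖LSeries u (s - t * I) - LSeries (fun n ↦ complMul e n * u n) s‖ ≤ ε := by
  -- the majorant `w n = ‖term u σ₁ n‖` and its tails
  set w : ℕ → ℝ := fun n ↦ ‖term u σ₁ n‖ with hw
  have hw0 : ∀ n, 0 ≤ w n := fun n ↦ norm_nonneg _
  have hwsum : Summable w := hσ₁.norm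
  have hC0 : 0 ≤ ∑' n, w n := tsum_nonneg hw0
  obtain ⟨Q, hQ⟩ := (Metric.tendsto_atTop.1 (tendsto_sum_nat_add w)) (ε / 4) (by positivity)
  have htail : ∑' k, w (k + Q) < ε / 4 := by
    have := hQ Q le_rfl
    rwa [Real.dist_eq, sub_zero, abs_of_nonneg (tsum_nonneg fun k ↦ hw0 _)] at this
  have hQC : 0 < (Q : ℝ) * (∑' n, w n) + 1 := by positivity
  have hη0 : 0 < ε / (2 * ((Q : ℝ) * (∑' n, w n) + 1)) := by positivity
  refine ⟨Q, ε / (2 * ((Q : ℝ) * (∑' n, w n) + 1)), hη0, fun t ht s hs ↦ ?_⟩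
  set η : ℝ := ε / (2 * ((Q : ℝ) * (∑' n, w n) + 1)) with hη
  have hsre : σ₁ ≤ s.re := hD s hs
  have hsum_s : LSeriesSummable u s :=
    (hσ₁.of_re_le_re (by simpa using hsre))
  -- the error coefficients
  set Gc : ℕ → ℂ := fun n ↦ ((n : ℂ) ^ ((t : ℂ) * I) - complMul e n) * u n with hGc
  have hcoef2 : ∀ n : ℕ, ‖(n : ℂ) ^ ((t : ℂ) * I) - complMul e n‖ ≤ 2 := by
    intro n
    refine (norm_sub_le _ _).trans ?_
    have h1 : ‖(n : ℂ) ^ ((t : ℂ) * I)‖ ≤ 1 := by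
      rcases eq_or_ne n 0 with rfl | hn
      · rcases eq_or_ne ((t : ℂ) * I) 0 with h0 | h0
        · simp [h0]
        · simp [zero_cpow h0]
      · rw [norm_natCast_cpow_of_pos (Nat.pos_of_ne_zero hn)]; simp
    have h2 : ‖complMul e n‖ ≤ 1 := norm_complMul_le_one (fun p hp ↦ (he p hp).le) n
    linarith
  have hGsum : LSeriesSummable Gc s := LSeriesSummable_mul_of_norm_le hcoef2 hsum_s
  -- `‖n^{it} − X(n)‖ ≤ n η` for `1 ≤ n ≤ Q`
  have hψ : ∀ n : ℕ, n ≠ 0 → n ≤ Q → ‖(n : ℂ) ^ ((t : ℂ) * I) - complMul e n‖ ≤ n * η := by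
    intro n hn hnQ
    have h := norm_complMul_sub_complMul_le (e₁ := shiftPhase (-t)) (e₂ := e)
      (fun p hp ↦ (norm_shiftPhase_prime (-t) p hp).le) (fun p hp ↦ (he p hp).le) hη0.le
      (Q := Q) (fun p hp hpQ ↦ ?_) n hn hnQ
    · rwa [complMul_shiftPhase hn, show -(((-t : ℝ)) : ℂ) * I = (t : ℂ) * I by push_cast; ring]
        at h
    · rw [shiftPhase_apply, show -(((-t : ℝ)) : ℂ) * I = (t : ℂ) * I by push_cast; ring]
      exact (ht p hp hpQ).le
  -- termwise majorant `B n = Q η w n + 2 [Q ≤ n] w n`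
  set B : ℕ → ℝ := fun n ↦ Q * η * w n + 2 * (if Q ≤ n then w n else 0) with hB
  have hind0 : ∀ n, 0 ≤ (if Q ≤ n then w n else 0) := by
    intro n
    split_ifs
    · exact hw0 n
    · exact le_rfl
  have hterm : ∀ n, ‖term Gc s n‖ ≤ B n := by
    intro n
    have hB0 : 0 ≤ B n := by
      simp only [hB]
      exact add_nonneg (mul_nonneg (mul_nonneg (Nat.cast_nonneg Q) hη0.le) (hw0 n))
        (mul_nonneg zero_le_two (hind0 n))
    rcases eq_or_ne n 0 with rfl | hn
    · simpa using hB0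
    -- `‖term Gc s n‖ ≤ ‖coef n‖ w n`
    have h1 : ‖term Gc s n‖ ≤ ‖(n : ℂ) ^ ((t : ℂ) * I) - complMul e n‖ * w n := by
      have hle := norm_term_le_of_re_le_re Gc (show ((σ₁ : ℝ) : ℂ).re ≤ s.re by simpa using hsre) n
      refine hle.trans (le_of_eq ?_)
      simp only [hw, norm_term_eq, if_neg hn, hGc, norm_mul, ofReal_re]
      ring
    refine h1.trans ?_
    by_cases hnQ : n ≤ Q
    · have h2 : ‖(n : ℂ) ^ ((t : ℂ) * I) - complMul e n‖ ≤ Q * η :=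
        (hψ n hn hnQ).trans (mul_le_mul_of_nonneg_right (by exact_mod_cast hnQ) hη0.le)
      have h3 := mul_le_mul_of_nonneg_right h2 (hw0 n)
      have h4 : 0 ≤ 2 * (if Q ≤ n then w n else 0) := mul_nonneg zero_le_two (hind0 n)
      simp only [hB]
      linarith
    · have hle : Q ≤ n := by omega
      have h3 := mul_le_mul_of_nonneg_right (hcoef2 n) (hw0 n)
      have h4 : 0 ≤ (Q : ℝ) * η * w n := mul_nonneg (mul_nonneg (Nat.cast_nonneg Q) hη0.le) (hw0 n)
      simp only [hB, if_pos hle]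
      linarith
  -- summing the majorant
  have hind : Summable fun n ↦ (if Q ≤ n then w n else 0) := by
    refine hwsum.of_nonneg_of_le hind0 (fun n ↦ ?_)
    split_ifs
    · exact le_rfl
    · exact hw0 n
  have hBsum : Summable B := (hwsum.mul_left _).add (hind.mul_left 2)
  have hind_eq : ∑' n, (if Q ≤ n then w n else 0) = ∑' k, w (k + Q) := by
    rw [← hind.sum_add_tsum_nat_add Q]
    have h0 : ∑ n ∈ Finset.range Q, (if Q ≤ n then w n else 0) = 0 :=
      Finset.sum_eq_zero fun n hn ↦ if_neg (by simp only [Finset.mem_range] at hn; omega)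
    rw [h0, zero_add]
    exact tsum_congr fun k ↦ if_pos (Nat.le_add_left Q k)
  have hBtsum : ∑' n, B n = Q * η * (∑' n, w n) + 2 * ∑' k, w (k + Q) := by
    simp only [hB]
    rw [(hwsum.mul_left _).tsum_add (hind.mul_left 2), tsum_mul_left, tsum_mul_left, hind_eq]
  have hmain : Q * η * (∑' n, w n) ≤ ε / 2 := by
    have h' : (Q : ℝ) * (∑' n, w n) / ((Q : ℝ) * (∑' n, w n) + 1) ≤ 1 :=
      (div_le_one hQC).2 (by linarith)
    have heq : (Q : ℝ) * η * (∑' n, w n) =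
        ε / 2 * ((Q : ℝ) * (∑' n, w n) / ((Q : ℝ) * (∑' n, w n) + 1)) := by
      rw [hη]
      field_simp
    rw [heq]
    calc ε / 2 * ((Q : ℝ) * (∑' n, w n) / ((Q : ℝ) * (∑' n, w n) + 1)) ≤ ε / 2 * 1 :=
          mul_le_mul_of_nonneg_left h' (by positivity)
      _ = ε / 2 := mul_one _
  calc ‖LSeries u (s - t * I) - LSeries (fun n ↦ complMul e n * u n) s‖
        = ‖∑' n, term Gc s n‖ := by rw [LSeries_shift_sub_twist he hsum_s t, LSeries]
    _ ≤ ∑' n, ‖term Gc s n‖ := norm_tsum_le_tsum_norm hGsum.norm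
    _ ≤ ∑' n, B n := hGsum.norm.tsum_le_tsum hterm hBsum
    _ = Q * η * (∑' n, w n) + 2 * ∑' k, w (k + Q) := hBtsum
    _ ≤ ε / 2 + 2 * (ε / 4) := by linarith [htail.le]
    _ = ε := by ring

/-! ## From a zero of `Z` to a zero of `G` -/

/-- **A zero of the twisted series produces a zero of the series** (Conrey–Ghosh's properties
(1) + (2) ⇒ zeros, via Kronecker and Rouché/Hurwitz). Let `G(s) = ∑ u(n)n^{-s}` converge
absolutely for `Re s ≥ σ₁`, let `X = complMul e` with `|e(p)| = 1`, and suppose the twist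
`Z(s) = ∑ X(n)u(n)n^{-s}` vanishes at a real point `σ₀ > σ₁`. Then `G` has a zero with real part
`> σ₁`. [cite: ConreyGhosh1994, §8, pp. 415–416] -/
theorem exists_LSeries_eq_zero_of_twist_zero {u e : ℕ → ℂ} (he : ∀ p, p.Prime → ‖e p‖ = 1)
    {σ₁ σ₀ : ℝ} (hσ : σ₁ < σ₀) (habs : abscissaOfAbsConv u < σ₁)
    (hZ : LSeries (fun n ↦ complMul e n * u n) σ₀ = 0) :
    ∃ s : ℂ, σ₁ < s.re ∧ LSeries u s = 0 := by
  set Xu : ℕ → ℂ := fun n ↦ complMul e n * u n with hXu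
  have hXabs : abscissaOfAbsConv Xu < σ₁ :=
    lt_of_le_of_lt (abscissaOfAbsConv_mul_le (K := 1)
      (norm_complMul_le_one fun p hp ↦ (he p hp).le)) habs
  have hU : IsOpen {s : ℂ | σ₁ < s.re} := isOpen_lt continuous_const continuous_re
  have hσ₀U : (σ₀ : ℂ) ∈ {s : ℂ | σ₁ < s.re} := by simpa using hσ
  have hanZ : AnalyticOnNhd ℂ (LSeries Xu) {s : ℂ | σ₁ < s.re} := fun s hs ↦
    LSeries_analyticOnNhd Xu s (lt_trans hXabs (by exact_mod_cast hs))
  rcases (hanZ σ₀ hσ₀U).eventually_eq_zero_or_eventually_ne_zero with hz | hnz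
  · -- `Z ≡ 0` near `σ₀`: then all `u(n)`, `n ≥ 1`, vanish and `G ≡ 0`
    have hconv : Convex ℝ {s : ℂ | σ₁ < s.re} := convex_halfSpace_re_gt σ₁
    have hEq : EqOn (LSeries Xu) 0 {s : ℂ | σ₁ < s.re} :=
      hanZ.eqOn_zero_of_preconnected_of_eventuallyEq_zero hconv.isPreconnected hσ₀U hz
    have hev : (fun x : ℝ ↦ LSeries Xu x) =ᶠ[atTop] 0 := by
      filter_upwards [eventually_gt_atTop σ₁] with x hx
      exact hEq (show (x : ℂ) ∈ {s : ℂ | σ₁ < s.re} by simpa using hx)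
    rcases LSeries_eventually_eq_zero_iff'.1 hev with h0 | htop
    · refine ⟨σ₀, by simpa using hσ, ?_⟩
      have hu0 : ∀ n, n ≠ 0 → u n = 0 := by
        intro n hn
        have := h0 n hn
        simp only [hXu, mul_eq_zero] at this
        rcases this with h1 | h1
        · exact absurd (norm_eq_zero.2 h1) (by rw [norm_complMul_eq_one he hn]; norm_num)
        · exact h1
      rw [LSeries_congr (f := u) (g := 0) (fun {n} hn ↦ by simpa using hu0 n hn), LSeries_zero]
      rfl
    · exfalso
      rw [htop] at hXabs
      exact not_top_lt hXabs
  -- `σ₀` is an isolated zero of `Z`: a small disc with zero-free boundary inside `Re s > σ₁`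
  have h' : ∀ᶠ z : ℂ in 𝓝 (σ₀ : ℂ), z ≠ (σ₀ : ℂ) → LSeries Xu z ≠ 0 :=
    eventually_nhdsWithin_iff.1 hnz
  obtain ⟨r₀, hr₀, hball⟩ := Metric.eventually_nhds_iff_ball.1 h'
  set r : ℝ := min (r₀ / 2) (σ₀ - σ₁) with hr_def
  have hr : 0 < r := lt_min (by positivity) (by linarith)
  have hrr₀ : r < r₀ := lt_of_le_of_lt (min_le_left _ _) (by linarith)
  have hrσ : r ≤ σ₀ - σ₁ := min_le_right _ _
  have hsub : closedBall (σ₀ : ℂ) r ⊆ ball (σ₀ : ℂ) r₀ := closedBall_subset_ball hrr₀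
  have hD : ∀ z ∈ closedBall (σ₀ : ℂ) r, σ₁ ≤ z.re := by
    intro z hz
    have h1 : |(z - σ₀).re| ≤ ‖z - (σ₀ : ℂ)‖ := abs_re_le_norm _
    rw [mem_closedBall, dist_eq_norm] at hz
    rw [sub_re, ofReal_re] at h1
    linarith [(abs_le.1 (h1.trans hz)).1]
  have hsphere : ∀ z ∈ sphere (σ₀ : ℂ) r, LSeries Xu z ≠ 0 := by
    intro z hz
    refine hball z (hsub (sphere_subset_closedBall hz)) ?_
    intro hzs
    rw [hzs, mem_sphere, dist_self] at hz
    exact hr.ne hz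
  -- Kronecker shifts with accuracy `1/(k+1)`
  have hσ₁sum : LSeriesSummable u σ₁ :=
    LSeriesSummable_of_abscissaOfAbsConv_lt_re (by simpa using habs)
  have hshift : ∀ k : ℕ, ∃ t : ℝ, ∀ s ∈ closedBall (σ₀ : ℂ) r,
      ‖LSeries u (s - t * I) - LSeries Xu s‖ ≤ 1 / ((k : ℝ) + 1) := by
    intro k
    obtain ⟨Q, η, hη, hQ⟩ := exists_forall_norm_shift_sub_twist_le he hσ₁sum hD
      (ε := 1 / ((k : ℝ) + 1)) (by positivity)
    obtain ⟨t, -, ht⟩ :=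
      Literature.NumberTheory.DiophantineApproximation.Kronecker.exists_abs_ge_forall_prime_norm_cpow_sub_lt
        Q e he hη 0
    exact ⟨t, hQ t ht⟩
  choose t ht using hshift
  set F : ℕ → ℂ → ℂ := fun k s ↦ LSeries u (s - t k * I) with hF
  have hunif : TendstoUniformlyOn F (LSeries Xu) atTop (closedBall (σ₀ : ℂ) r) := by
    rw [Metric.tendstoUniformlyOn_iff]
    intro ε hε
    obtain ⟨k₀, hk₀⟩ := exists_nat_one_div_lt hε
    filter_upwards [eventually_ge_atTop k₀] with k hk s hs
    rw [dist_comm, dist_eq_norm]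
    refine (ht k s hs).trans_lt (lt_of_le_of_lt ?_ hk₀)
    have hk' : (k₀ : ℝ) ≤ k := by exact_mod_cast hk
    gcongr
  have hV : IsOpen {s : ℂ | abscissaOfAbsConv u < s.re} := isOpen_re_gt_EReal _
  have hFdiff : ∀ᶠ k in atTop, DiffContOnCl ℂ (F k) (ball (σ₀ : ℂ) r) := by
    refine Eventually.of_forall fun k ↦ ?_
    have hdiff : DifferentiableOn ℂ (F k) {s : ℂ | abscissaOfAbsConv u < s.re} := by
      intro z hz
      have hz' : abscissaOfAbsConv u < (z - t k * I).re := by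
        have : (z - t k * I).re = z.re := by simp
        rw [this]; exact hz
      exact (((LSeries_hasDerivAt hz').differentiableAt).comp z
        (differentiableAt_id.sub_const _)).differentiableWithinAt
    refine hdiff.diffContOnCl_ball fun z hz ↦ ?_
    exact lt_of_lt_of_le habs (by exact_mod_cast hD z hz)
  have hcont : ContinuousOn (LSeries Xu) (sphere (σ₀ : ℂ) r) := by
    refine (LSeries_analyticOnNhd Xu).continuousOn.mono fun z hz ↦ ?_
    exact lt_of_lt_of_le hXabs (by exact_mod_cast hD z (sphere_subset_closedBall hz))
  have hev := Complex.eventually_exists_zero_mem_ball_of_tendstoUniformlyOn hr hFdiff hunif hcont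
    hZ hsphere
  obtain ⟨k, z, hz, hz0⟩ := hev.exists
  refine ⟨z - t k * I, ?_, hz0⟩
  have h1 : |(z - σ₀).re| ≤ ‖z - (σ₀ : ℂ)‖ := abs_re_le_norm _
  rw [mem_ball, dist_eq_norm] at hz
  rw [sub_re, ofReal_re] at h1
  have : σ₀ - r < z.re := by linarith [(abs_lt.1 (lt_of_le_of_lt h1 hz)).1]
  simp only [sub_re, mul_re, ofReal_re, Complex.I_re, ofReal_im, Complex.I_im]
  linarith


/-! ## The real zero of the twisted difference `Z = (εa)-series − (εb)-series` -/

/-- `ε(n)² = 1` (`n ≥ 1`) for a completely multiplicative `ε` with `ε(p)² = 1`. [folklore] -/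
theorem sq_eq_one_of_mul {ε : ℕ → ℝ} (hε1 : ε 1 = 1) (hεmul : ∀ m n, ε (m * n) = ε m * ε n)
    (hεsq : ∀ p, p.Prime → ε p ^ 2 = 1) {n : ℕ} (hn : n ≠ 0) : ε n ^ 2 = 1 := by
  induction n using Nat.recOnPosPrimePosCoprime with
  | prime_pow p k hp hk =>
    have hpow : ∀ j : ℕ, ε (p ^ j) = ε p ^ j := by
      intro j
      induction j with
      | zero => simp [hε1]
      | succ j ih => rw [pow_succ, hεmul, ih, pow_succ]
    rw [hpow, ← pow_mul, mul_comm, pow_mul, hεsq p hp, one_pow]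
  | zero => exact absurd rfl hn
  | one => simp [hε1]
  | coprime a b ha hb hab iha ihb =>
    rw [hεmul, mul_pow, iha (by omega), ihb (by omega), one_mul]

/-- `ε(p^j) = ε(p)^j` for a completely multiplicative `ε` with `ε(1) = 1`. [folklore] -/
theorem apply_prime_pow_of_mul {ε : ℕ → ℝ} (hε1 : ε 1 = 1) (hεmul : ∀ m n, ε (m * n) = ε m * ε n)
    (p j : ℕ) : ε (p ^ j) = ε p ^ j := by
  induction j with
  | zero => simp [hε1]
  | succ j ih => rw [pow_succ, hεmul, ih, pow_succ]

/-- **A real zero of the twisted difference series** (the heart of Conrey–Ghosh's argument for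
`Δ²`, §8, pp. 415–417, with the Lemma of §9 replaced by a finite certificate). Let `a`, `b` be
real Hecke-type coefficient systems of "weight exponent" `m` (`a(p^{r+2}) = a(p)a(p^{r+1}) −
p^m a(p^r)`), absolutely summable to the right of `σ_c` with `m + 1 < 2σ_c`, and `ε = ±1` a
completely multiplicative sign with `ε(2)(a(2) − b(2)) < 0` and `ε(p)(a(p) − b(p)) ≥ 0` for the
odd primes. If at some `σ₁ > σ_c` the finitely many Euler denominators at a finite set of primes
`T ∋ 2` satisfy `∏_{p∈T}(1 − ε(p)a(p)p^{-σ₁} + p^{m−2σ₁}) < ∏_{p∈T}(1 − ε(p)b(p)p^{-σ₁} + p^{m−2σ₁})`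
(the CERTIFICATE), then `Z(σ) = ∑ ε(n)(a(n) − b(n))n^{-σ}` is `> 0` at `σ₁`, `< 0` far to the
right, hence vanishes at some real `σ₀ > σ_c`. [cite: ConreyGhosh1994, §8, pp. 415–417] -/
theorem exists_real_zero_of_cert {a b ε : ℕ → ℝ} {m : ℕ} {σc : ℝ}
    (ha1 : a 1 = 1) (hb1 : b 1 = 1)
    (hamul : ∀ {m n : ℕ}, m.Coprime n → a (m * n) = a m * a n)
    (hbmul : ∀ {m n : ℕ}, m.Coprime n → b (m * n) = b m * b n)
    (harec : ∀ {p : ℕ}, p.Prime → ∀ r : ℕ, a (p ^ (r + 2)) = a p * a (p ^ (r + 1)) - (p : ℝ) ^ m * a (p ^ r))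
    (hbrec : ∀ {p : ℕ}, p.Prime → ∀ r : ℕ, b (p ^ (r + 2)) = b p * b (p ^ (r + 1)) - (p : ℝ) ^ m * b (p ^ r))
    (hε1 : ε 1 = 1) (hεmul : ∀ m n, ε (m * n) = ε m * ε n) (hεsq : ∀ p, p.Prime → ε p ^ 2 = 1)
    (hsa : ∀ σ : ℝ, σc < σ → LSeriesSummable (fun n ↦ (a n : ℂ)) σ)
    (hsb : ∀ σ : ℝ, σc < σ → LSeriesSummable (fun n ↦ (b n : ℂ)) σ)
    (hm : (m : ℝ) + 1 < 2 * σc)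
    (h2 : ε 2 * (a 2 - b 2) < 0)
    (hsign : ∀ p : ℕ, p.Prime → p ≠ 2 → 0 ≤ ε p * (a p - b p))
    {σ₁ : ℝ} (hσ₁ : σc < σ₁) {T : Finset ℕ} (hT2 : 2 ∈ T) (hTp : ∀ n ∈ T, n.Prime)
    (hcert : ∏ n ∈ T, (1 - ε n * a n * (n : ℝ) ^ (-σ₁) + (n : ℝ) ^ m * ((n : ℝ) ^ (-σ₁)) ^ 2) <
      ∏ n ∈ T, (1 - ε n * b n * (n : ℝ) ^ (-σ₁) + (n : ℝ) ^ m * ((n : ℝ) ^ (-σ₁)) ^ 2)) :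
    ∃ σ₀ : ℝ, σ₁ < σ₀ ∧ LSeries (fun n ↦ ((ε n * (a n - b n) : ℝ) : ℂ)) σ₀ = 0 := by
  -- the twisted systems
  obtain ⟨A', hA'⟩ : ∃ f : ℕ → ℝ, f = fun n ↦ ε n * a n := ⟨_, rfl⟩
  obtain ⟨B', hB'⟩ : ∃ f : ℕ → ℝ, f = fun n ↦ ε n * b n := ⟨_, rfl⟩
  obtain ⟨e, he⟩ : ∃ f : ℕ → ℝ, f = fun n : ℕ ↦ (n : ℝ) ^ m := ⟨_, rfl⟩
  have hεpow := apply_prime_pow_of_mul hε1 hεmul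
  have hεabs : ∀ n, n ≠ 0 → |ε n| = 1 := fun n hn ↦ by
    have h := sq_eq_one_of_mul hε1 hεmul hεsq hn
    rw [← sq_abs] at h
    nlinarith [abs_nonneg (ε n)]
  have hεle : ∀ n, |ε n| ≤ max 1 |ε 0| := by
    intro n
    rcases eq_or_ne n 0 with rfl | hn
    · exact le_max_right _ _
    · rw [hεabs n hn]; exact le_max_left _ _
  -- Euler-type hypotheses for the twisted systems
  have hA1 : A' 1 = 1 := by rw [hA']; simp [hε1, ha1]
  have hB1 : B' 1 = 1 := by rw [hB']; simp [hε1, hb1]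
  have hAmul : ∀ {m n : ℕ}, m.Coprime n → A' (m * n) = A' m * A' n := by
    intro m' n hmn; rw [hA']; simp only [hεmul, hamul hmn]; ring
  have hBmul : ∀ {m n : ℕ}, m.Coprime n → B' (m * n) = B' m * B' n := by
    intro m' n hmn; rw [hB']; simp only [hεmul, hbmul hmn]; ring
  have hrec_twist : ∀ {c : ℕ → ℝ},
      (∀ {p : ℕ}, p.Prime → ∀ r : ℕ, c (p ^ (r + 2)) = c p * c (p ^ (r + 1)) - (p : ℝ) ^ m * c (p ^ r)) →
      ∀ {p : ℕ}, p.Prime → ∀ r : ℕ, ε (p ^ (r + 2)) * c (p ^ (r + 2)) =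
        ε p * c p * (ε (p ^ (r + 1)) * c (p ^ (r + 1))) - e p * (ε (p ^ r) * c (p ^ r)) := by
    intro c hc p hp r
    rw [hc hp r, hεpow, hεpow, hεpow, he]
    linear_combination (-((p : ℝ) ^ m * c (p ^ r) * ε p ^ r)) * hεsq p hp
  have hArec : ∀ {p : ℕ}, p.Prime → ∀ r : ℕ, A' (p ^ (r + 2)) = A' p * A' (p ^ (r + 1)) - e p * A' (p ^ r) := by
    intro p hp r; rw [hA']; exact hrec_twist (fun hp r ↦ harec hp r) hp r
  have hBrec : ∀ {p : ℕ}, p.Prime → ∀ r : ℕ, B' (p ^ (r + 2)) = B' p * B' (p ^ (r + 1)) - e p * B' (p ^ r) := by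
    intro p hp r; rw [hB']; exact hrec_twist (fun hp r ↦ hbrec hp r) hp r
  -- summability of the twisted systems
  have htwist_sum : ∀ {c : ℕ → ℝ} {s : ℂ}, LSeriesSummable (fun n ↦ (c n : ℂ)) s →
      LSeriesSummable (fun n ↦ ((ε n * c n : ℝ) : ℂ)) s := by
    intro c s hs
    have h := LSeriesSummable_mul_of_norm_le (c := fun n ↦ (ε n : ℂ)) (u := fun n ↦ (c n : ℂ))
      (K := max 1 |ε 0|) (fun n ↦ by rw [Complex.norm_real, Real.norm_eq_abs]; exact hεle n) hs
    refine (LSeriesSummable_congr s fun {n} _ ↦ ?_).1 h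
    push_cast; ring
  have hsA : ∀ σ : ℝ, σc < σ → LSeriesSummable (fun n ↦ (A' n : ℂ)) σ := fun σ hσ ↦ by
    rw [hA']; exact htwist_sum (hsa σ hσ)
  have hsB : ∀ σ : ℝ, σc < σ → LSeriesSummable (fun n ↦ (B' n : ℂ)) σ := fun σ hσ ↦ by
    rw [hB']; exact htwist_sum (hsb σ hσ)
  -- prime sums `∑_p (|c p| p^{-σ} + p^m p^{-2σ}) < ∞`
  have hprime_sum : ∀ {c c' : ℕ → ℝ} {σ : ℝ}, c' = (fun n ↦ ε n * c n) → σc < σ →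
      LSeriesSummable (fun n ↦ (c n : ℂ)) σ →
      Summable fun p : Nat.Primes ↦ |c' p| * (p : ℝ) ^ (-σ) + |e p| * ((p : ℝ) ^ (-σ)) ^ 2 := by
    intro c c' σ hc' hσ hs
    have h1 : Summable fun p : Nat.Primes ↦ |c' p| * (p : ℝ) ^ (-σ) := by
      have h := hs.norm.comp_injective Nat.Primes.coe_nat_injective
      refine h.congr fun p ↦ ?_
      have hp0 : (p : ℕ) ≠ 0 := p.2.ne_zero
      simp only [Function.comp_apply, norm_term_eq, if_neg hp0, Complex.norm_real, Real.norm_eq_abs,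
        ofReal_re, hc', abs_mul, hεabs _ hp0, one_mul]
      rw [Real.rpow_neg (Nat.cast_nonneg _), div_eq_mul_inv]
    have h2 : Summable fun p : Nat.Primes ↦ |e p| * ((p : ℝ) ^ (-σ)) ^ 2 := by
      have hq : (m : ℝ) - 2 * σ < -1 := by linarith
      have h := (Real.summable_nat_rpow.2 hq).comp_injective Nat.Primes.coe_nat_injective
      refine h.congr fun p ↦ ?_
      have hp0 : (0 : ℝ) < (p : ℕ) := by exact_mod_cast p.2.pos
      simp only [Function.comp_apply, he]
      rw [abs_of_nonneg (pow_nonneg hp0.le _), ← Real.rpow_natCast, ← Real.rpow_natCast,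
        ← Real.rpow_mul hp0.le, ← Real.rpow_add hp0]
      congr 1; push_cast; ring
    exact h1.add h2
  -- positivity of all Euler denominators on the whole half-line
  have hpos : ∀ {c : ℕ → ℝ}, c 1 = 1 → (∀ {m n : ℕ}, m.Coprime n → c (m * n) = c m * c n) →
      (∀ {p : ℕ}, p.Prime → ∀ r : ℕ, c (p ^ (r + 2)) = c p * c (p ^ (r + 1)) - e p * c (p ^ r)) →
      (∀ σ : ℝ, σc < σ → LSeriesSummable (fun n ↦ (c n : ℂ)) σ) →
      ∀ {σ : ℝ}, σc < σ → ∀ p : Nat.Primes,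
        0 < 1 - c p * (p : ℝ) ^ (-σ) + e p * ((p : ℝ) ^ (-σ)) ^ 2 := by
    intro c hc1 hcmul hcrec hcs σ hσ p
    refine eulerQuadratic_pos p.2.two_le (c p) (e p) (σ₀ := σc) (fun σ' hσ' ↦ ?_) hσ
    exact (hasProd_re_LSeries_of_recurrence hc1 hcmul hcrec (hcs σ' hσ')).2.2 p
  have hAq : ∀ {σ : ℝ}, σc < σ → ∀ p : Nat.Primes, 0 < 1 - A' p * (p : ℝ) ^ (-σ) + e p * ((p : ℝ) ^ (-σ)) ^ 2 :=
    fun hσ ↦ hpos hA1 hAmul hArec hsA hσ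
  have hBq : ∀ {σ : ℝ}, σc < σ → ∀ p : Nat.Primes, 0 < 1 - B' p * (p : ℝ) ^ (-σ) + e p * ((p : ℝ) ^ (-σ)) ^ 2 :=
    fun hσ ↦ hpos hB1 hBmul hBrec hsB hσ
  -- the difference series `Z` and its values on the real axis
  obtain ⟨Zc, hZc⟩ : ∃ f : ℕ → ℂ, f = fun n ↦ ((ε n * (a n - b n) : ℝ) : ℂ) := ⟨_, rfl⟩
  rw [← hZc]
  have hZ_eq : ∀ {σ : ℝ}, σc < σ → LSeries Zc σ =
      LSeries (fun n ↦ (A' n : ℂ)) σ - LSeries (fun n ↦ (B' n : ℂ)) σ := by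
    intro σ hσ
    rw [← LSeries_sub (hsA σ hσ) (hsB σ hσ), hZc, hA', hB']
    congr 1
    funext n
    simp only [Pi.sub_apply]
    push_cast; ring
  have hZ_im : ∀ {σ : ℝ}, σc < σ → (LSeries Zc σ).im = 0 := by
    intro σ hσ
    rw [hZ_eq hσ, sub_im, (hasProd_re_LSeries_of_recurrence hA1 hAmul hArec (hsA σ hσ)).2.1,
      (hasProd_re_LSeries_of_recurrence hB1 hBmul hBrec (hsB σ hσ)).2.1, sub_zero]
  -- `Z(σ₁) > 0` from the certificate (transported to `Finset Nat.Primes`)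
  have hcomp : ∀ p : Nat.Primes, p ∉ T.subtype Nat.Prime →
      1 - A' p * (p : ℝ) ^ (-σ₁) + e p * ((p : ℝ) ^ (-σ₁)) ^ 2 ≤
        1 - B' p * (p : ℝ) ^ (-σ₁) + e p * ((p : ℝ) ^ (-σ₁)) ^ 2 := by
    intro p hp
    have hp2 : (p : ℕ) ≠ 2 := by
      intro h
      exact hp (Finset.mem_subtype.mpr (by rw [h]; exact hT2))
    have hs := hsign p p.2 hp2
    have hx : 0 ≤ ((p : ℕ) : ℝ) ^ (-σ₁) := Real.rpow_nonneg (Nat.cast_nonneg _) _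
    rw [hA', hB']
    nlinarith [mul_nonneg hs hx]
  have hc2 : ∏ n ∈ T, (1 - A' n * (n : ℝ) ^ (-σ₁) + e n * ((n : ℝ) ^ (-σ₁)) ^ 2) <
      ∏ n ∈ T, (1 - B' n * (n : ℝ) ^ (-σ₁) + e n * ((n : ℝ) ^ (-σ₁)) ^ 2) := by
    rw [hA', hB', he]; simpa only using hcert
  have hcert' : ∏ p ∈ T.subtype Nat.Prime, (1 - A' p * ((p : ℕ) : ℝ) ^ (-σ₁) +
        e p * (((p : ℕ) : ℝ) ^ (-σ₁)) ^ 2) <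
      ∏ p ∈ T.subtype Nat.Prime, (1 - B' p * ((p : ℕ) : ℝ) ^ (-σ₁) +
        e p * (((p : ℕ) : ℝ) ^ (-σ₁)) ^ 2) := by
    rw [Finset.prod_subtype_of_mem (fun n : ℕ ↦ 1 - A' n * (n : ℝ) ^ (-σ₁) + e n * ((n : ℝ) ^ (-σ₁)) ^ 2) hTp,
      Finset.prod_subtype_of_mem (fun n : ℕ ↦ 1 - B' n * (n : ℝ) ^ (-σ₁) + e n * ((n : ℝ) ^ (-σ₁)) ^ 2) hTp]
    exact hc2
  have hZ₁ : 0 < (LSeries Zc σ₁).re := by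
    have h := re_LSeries_lt_of_prod_lt hA1 hB1 hAmul hBmul hArec hBrec (hsA σ₁ hσ₁) (hsB σ₁ hσ₁)
      (hprime_sum hA' hσ₁ (hsa σ₁ hσ₁)) (hprime_sum hB' hσ₁ (hsb σ₁ hσ₁)) (hAq hσ₁) (hBq hσ₁) (T.subtype Nat.Prime) hcomp hcert'
    rw [hZ_eq hσ₁, sub_re]
    linarith
  -- `Z(σ₂) < 0` far to the right
  have hZc1 : Zc 1 = 0 := by rw [hZc]; simp [ha1, hb1]
  have hZc2 : (Zc 2).re < 0 := by rw [hZc]; simpa using h2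
  have hZsummable : ∀ {y : ℝ}, σc < y → LSeriesSummable Zc y := by
    intro y hy
    have h := (hsA y hy).sub (hsB y hy)
    rw [hA', hB'] at h
    rw [hZc]
    refine (LSeriesSummable_congr _ fun {n} _ ↦ ?_).1 h
    simp only [Pi.sub_apply]; push_cast; ring
  have hZsum : LSeriesSummable Zc (((σc + 1 : ℝ)) : ℂ) := hZsummable (by linarith)
  obtain ⟨σ₂, hZ₂, hσ₁₂⟩ := ((eventually_re_LSeries_neg hZc1 hZsum hZc2).and
    (eventually_gt_atTop σ₁)).exists
  -- intermediate value theorem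
  have habsZ : abscissaOfAbsConv Zc < σ₁ := by
    exact lt_of_le_of_lt (abscissaOfAbsConv_le_of_forall_lt_LSeriesSummable fun y hy ↦ hZsummable hy)
      (by exact_mod_cast hσ₁ : ((σc : ℝ) : EReal) < σ₁)
  obtain ⟨σ₀, h₀₁, -, h0⟩ := exists_LSeries_ofReal_eq_zero hσ₁₂ habsZ
    (fun σ hσ ↦ hZ_im (lt_of_lt_of_le hσ₁ hσ)) hZ₁ hZ₂
  exact ⟨σ₀, h₀₁, h0⟩

end Literature.Barriers.RiemannHypothesis

end
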